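import Summits.NavierStokesRegularity.NavierStokesRegularity.Theorems.PerpetualPumpCircuitPumpActiveCoreLemmas
import Summits.NavierStokesRegularity.NavierStokesRegularity.Theorems.PerpetualPumpCircuitPumpGateRadius

/-!
# Active block of the Toda pump over one period: the gate variables
# (crux `PerpetualPump.CircuitPump`, stmt-NavierStokesRegularity-1834; line `singular-clock-gspt`,
# helper `toda_gate_period` for the sub-goal `toda_active_core` of `stub_clockBox`)

The damped Toda transfer gate `u' = −u − v² + p`, `v' = v(u − w) − v + s`, `w' = −νw + v² + r`
on `[0, T]`, `T ≤ 1/2` (`|p|, |r| ≤ 3`, `0 ≤ s ≤ Ps ≤ 3`, `ν ∈ [1, 3/2]`, `u(0) = A ≥ 40000`,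
`w(0) ∈ [0, 1]`, `v(0) ∈ (0, 1]`, seed small against the initial bond: `32 Ps ≤ A v(0)`), over
ONE PERIOD: with the half fuse `ℓ = log((A/8)/v(0))`, the rise-end bracket
`τ∓ = −log(1 − (ℓ − 6/5)/A), −log(1 − (ℓ + 11/5)/A)` and `t₃ = τ⁺ + (250 + 16 log A)/A ≤ T`:
(i) global brackets (`toda_gate_sigma`: `|σ| ≤ 37/2`, `R ≥ A/3`, `u ≥ σ/2`);
(ii) the bond first reaches `A/8` at a time `tg ∈ [τ⁻, τ⁺]` (first exit time of `v ≤ A/8`,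
`Literature.Analysis.ODE.maximalTimeP`, bracketed by the two clock bounds of `toda_rise_clock`),
with the rise brackets of `riseClock_boot`/`riseClock_phase` on `[0, tg]`;
(iii) from `τ⁺ + 250/A` on the gate is flipped, `D ≤ −(9/10)R`, the bond decays and the new
carrier holds `w ≥ 3A/10` (`toda_gate_flip_of_entry`);
(iv) `|R(t₃) − A e^{−tg}| ≤ 830 + 48 log A` (`toda_gate_R` (a) at `tg`, `|S'| ≤ 3A` across
`[tg, t₃]`, `t₃ − tg ≤ (255 + 16 log A)/A`, and `R = S − σ`);
(v) for `t ≥ t₃`: `v ≤ 3/2`, `|u| ≤ 10`, and `w` follows `R(t₃) e^{−ν(t−t₃)}` within `26`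
(`toda_gate_R` (b) and `gate_flipped_geometry`).
The arithmetic is isolated in pointwise lemmas (`period_pt_*`, `period_levels`, `period_before`,
`period_after`). [folklore]
-/

noncomputable section

-- the summit namespace `…NavierStokesRegularity.NavierStokesRegularity…` is the tree convention
set_option linter.dupNamespace false

namespace Summit.NavierStokesRegularity.NavierStokesRegularity.Theorems.PerpetualPumpCircuitPump

open Set Filter Topology Literature.Analysis.ODE

/-- Pointwise global brackets from the `σ`-lemma (`P = 3`, `ν ≤ 3/2`, `t ≤ 1/2`): `|σ| ≤ 37/2`,
`u = (σ + R + D)/2 ≥ σ/2 ≥ −10`, `w ≥ −3t ≥ −3/2`, `w = S − u ≤ A + 15`, `u = S − w ≤ A + 10`.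
[folklore] -/
theorem period_pt_apriori {ν t A U V W : ℝ} (hν2 : ν ≤ 3 / 2) (ht : t ≤ 1 / 2)
    (hwlo : -(3 * t) ≤ W) (hSup : U + W ≤ A + 1 + 3 * 3 * t)
    (hσ : |U + W - Real.sqrt ((U - W) ^ 2 + 2 * V ^ 2)| ≤ 2 + 15 * (ν - 1) + 6 * 3 * t) :
    -10 ≤ U ∧ U ≤ A + 10 ∧ -(3 / 2) ≤ W ∧ W ≤ A + 15 ∧
      |U + W - Real.sqrt ((U - W) ^ 2 + 2 * V ^ 2)| ≤ 37 / 2 := by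
  have hDR : |U - W| ≤ Real.sqrt ((U - W) ^ 2 + 2 * V ^ 2) :=
    Real.abs_le_sqrt (by nlinarith [sq_nonneg V])
  have hσ' : |U + W - Real.sqrt ((U - W) ^ 2 + 2 * V ^ 2)| ≤ 37 / 2 := hσ.trans (by linarith)
  obtain ⟨hσ1, hσ2⟩ := abs_le.mp hσ'
  obtain ⟨hD1, hD2⟩ := abs_le.mp hDR
  exact ⟨by linarith, by linarith, by linarith, by linarith, hσ'⟩

/-- Numerics of the clock levels `q⁺ = 1 − (ℓ + 11/5)/A`, `q⁻ = 1 − (ℓ − 6/5)/A`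
(`ℓ = log(A/8) − log v₀ ≤ A/8 + A/10`): `q⁺ ≥ 3/4`, `q⁻ > 0`, and
`τ⁺ − τ⁻ = log(q⁻/q⁺) ≤ (q⁻ − q⁺)/q⁺ ≤ 5/A`. [folklore] -/
theorem period_levels {A ℓ v0 : ℝ} (hA : 40000 ≤ A)
    (hlogv : -Real.log v0 ≤ A / 10) (hℓ : ℓ = Real.log (A / 8) - Real.log v0) :
    3 / 4 ≤ 1 - (ℓ + 11 / 5) / A ∧ 0 < 1 - (ℓ - 6 / 5) / A ∧
      A * (1 - (ℓ + 11 / 5) / A) = A - (ℓ + 11 / 5) ∧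
      A * (1 - (ℓ - 6 / 5) / A) = A - (ℓ - 6 / 5) ∧
      -Real.log (1 - (ℓ + 11 / 5) / A) - -Real.log (1 - (ℓ - 6 / 5) / A) ≤ 5 / A := by
  have hA0 : 0 < A := by linarith
  have hlogA8 : Real.log (A / 8) ≤ A / 8 - 1 := Real.log_le_sub_one_of_pos (by positivity)
  have hqA : A * (1 - (ℓ + 11 / 5) / A) = A - (ℓ + 11 / 5) := by field_simp
  have hqA' : A * (1 - (ℓ - 6 / 5) / A) = A - (ℓ - 6 / 5) := by field_simp
  have hqp0 : 3 / 4 ≤ 1 - (ℓ + 11 / 5) / A := by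
    refine le_of_mul_le_mul_left ?_ hA0
    rw [hqA, hℓ]; linarith
  have hqmp : 1 - (ℓ - 6 / 5) / A = (1 - (ℓ + 11 / 5) / A) + 17 / 5 / A := by
    field_simp; ring
  have hqp_pos : 0 < 1 - (ℓ + 11 / 5) / A := by linarith
  have hqm_pos : 0 < 1 - (ℓ - 6 / 5) / A := by rw [hqmp]; positivity
  refine ⟨hqp0, hqm_pos, hqA, hqA', ?_⟩
  have h1 := Real.log_le_sub_one_of_pos (div_pos hqm_pos hqp_pos)
  rw [Real.log_div hqm_pos.ne' hqp_pos.ne'] at h1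
  have h2 : (1 - (ℓ - 6 / 5) / A) / (1 - (ℓ + 11 / 5) / A) ≤ 1 + 5 / A := by
    rw [div_le_iff₀ hqp_pos, hqmp]
    have h3 : 17 / 5 / A ≤ 5 / A * (1 - (ℓ + 11 / 5) / A) := by
      rw [div_mul_eq_mul_div, div_le_div_iff_of_pos_right hA0]; linarith
    linarith
  linarith

/-- Before the bond reaches `A/8`: the lower clock bound `A(1 − e^{−t}) − 2t − 3t² − 1/30 ≤ log(v/v₀)`
with `v ≤ A/8` forces `A(1 − e^{−t}) < ℓ + 11/5`, i.e. `t < τ⁺`. [folklore] -/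
theorem period_before {A ℓ t v0 vt : ℝ} (hA : 40000 ≤ A) (ht0 : 0 ≤ t) (ht : t ≤ 1 / 2)
    (hv0 : 0 < v0) (hvt : 0 < vt) (hv8 : vt ≤ A / 8) (hℓ : ℓ = Real.log (A / 8) - Real.log v0)
    (hq : 0 < 1 - (ℓ + 11 / 5) / A) (hqA : A * (1 - (ℓ + 11 / 5) / A) = A - (ℓ + 11 / 5))
    (hlow : A * (1 - Real.exp (-t)) - 2 * t - 3 * t ^ 2 - 1 / 30 ≤ Real.log (vt / v0)) :
    t < -Real.log (1 - (ℓ + 11 / 5) / A) := by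
  have hA0 : 0 < A := by linarith
  have h1 : Real.log (vt / v0) ≤ ℓ := by
    have h := Real.log_le_log (div_pos hvt hv0) (div_le_div_of_nonneg_right hv8 hv0.le)
    have e : Real.log (A / 8 / v0) = Real.log (A / 8) - Real.log v0 :=
      Real.log_div (by positivity) hv0.ne'
    rw [e] at h
    rw [hℓ]; exact h
  have hsq : t ^ 2 ≤ 1 / 4 := by nlinarith
  have h2 : A * (1 - Real.exp (-t)) < ℓ + 11 / 5 := by linarith
  have h3 : 1 - (ℓ + 11 / 5) / A < Real.exp (-t) := by
    refine lt_of_mul_lt_mul_left ?_ hA0.le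
    rw [hqA]; linarith
  have h4 := (Real.log_lt_iff_lt_exp hq).mpr h3
  linarith

/-- At the gate time: the upper clock bound at `v(tg) = A/8` (seed term
`log(1 + 2Ps/(A v₀)) ≤ 1/16`, `3tg² − tg ≤ 1/4`) forces `A(1 − e^{−tg}) > ℓ − 6/5`, i.e. `τ⁻ < tg`.
[folklore] -/
theorem period_after {A ℓ tg v0 Ps : ℝ} (hA : 40000 ≤ A) (htg0 : 0 ≤ tg) (htg : tg ≤ 1 / 2)
    (hv0 : 0 < v0) (hPs0 : 0 ≤ Ps) (hPsv : 32 * Ps ≤ A * v0)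
    (hℓ : ℓ = Real.log (A / 8) - Real.log v0)
    (hq : 0 < 1 - (ℓ - 6 / 5) / A) (hqA : A * (1 - (ℓ - 6 / 5) / A) = A - (ℓ - 6 / 5))
    (hup : Real.log (A / 8 / v0) ≤
      A * (1 - Real.exp (-tg)) - tg + 3 * tg ^ 2 + Real.log (1 + 2 * Ps / (A * v0))) :
    -Real.log (1 - (ℓ - 6 / 5) / A) < tg := by
  have hA0 : 0 < A := by linarith
  have h1 : Real.log (A / 8 / v0) = ℓ := by rw [Real.log_div (by positivity) hv0.ne', hℓ]
  have h2 : Real.log (1 + 2 * Ps / (A * v0)) ≤ 1 / 16 := by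
    have hx : 2 * Ps / (A * v0) ≤ 1 / 16 := by
      rw [div_le_iff₀ (by positivity)]; linarith
    have := Real.log_le_sub_one_of_pos (x := 1 + 2 * Ps / (A * v0)) (by positivity)
    linarith
  have hsq : 3 * tg ^ 2 - tg ≤ 1 / 4 := by
    nlinarith [mul_nonneg htg0 (by linarith : (0 : ℝ) ≤ 1 / 2 - tg)]
  have h3 : ℓ - 6 / 5 < A * (1 - Real.exp (-tg)) := by rw [h1] at hup; linarith
  have h4 : Real.exp (-tg) < 1 - (ℓ - 6 / 5) / A := by
    refine lt_of_mul_lt_mul_left ?_ hA0.le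
    rw [hqA]; linarith
  have h5 := (Real.lt_log_iff_exp_lt hq).mpr h4
  linarith

/-- Pointwise flipped-gate bound for the new carrier: `D ≤ −(9/10)R`, `S ≥ R − 37/2`, `R ≥ A/3`
give `w = (S − D)/2 ≥ (19/20)(A/3) − 37/4 ≥ 3A/10`. [folklore] -/
theorem period_pt_flip {A U V W : ℝ} (hA : 40000 ≤ A)
    (hR3 : A / 3 ≤ Real.sqrt ((U - W) ^ 2 + 2 * V ^ 2))
    (hσ : |U + W - Real.sqrt ((U - W) ^ 2 + 2 * V ^ 2)| ≤ 37 / 2)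
    (hDf : U - W ≤ -(9 / 10) * Real.sqrt ((U - W) ^ 2 + 2 * V ^ 2)) : 3 * A / 10 ≤ W := by
  obtain ⟨hσ1, -⟩ := abs_le.mp hσ
  linarith

/-- Pointwise slope bound for `S = u + w`: `|S'| = |−u − νw + p + r| ≤ 3A` from the global
brackets. [folklore] -/
theorem period_pt_slope {ν A U V W pp rr : ℝ} (hν1 : 1 ≤ ν) (hν2 : ν ≤ 3 / 2) (hA : 40000 ≤ A)
    (hulo : -10 ≤ U) (huhi : U ≤ A + 10) (hwlo : -(3 / 2) ≤ W) (hwhi : W ≤ A + 15)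
    (hp : |pp| ≤ 3) (hr : |rr| ≤ 3) :
    |-U - V ^ 2 + pp + (-ν * W + V ^ 2 + rr)| ≤ 3 * A := by
  obtain ⟨hp1, hp2⟩ := abs_le.mp hp
  obtain ⟨hr1, hr2⟩ := abs_le.mp hr
  have hν0 : (0 : ℝ) ≤ ν := by linarith
  have e1 : ν * W ≤ ν * (A + 15) := mul_le_mul_of_nonneg_left hwhi hν0
  have e2 : ν * (A + 15) ≤ 3 / 2 * (A + 15) := mul_le_mul_of_nonneg_right hν2 (by linarith)
  have e3 : ν * (-(3 / 2)) ≤ ν * W := mul_le_mul_of_nonneg_left hwlo hν0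
  rw [abs_le]
  constructor <;> nlinarith

/-- Pointwise assembly of the radius at `t₃`: `R(t₃) − A e^{−tg} = (R − S)(t₃) + (S(t₃) − S(tg))
+ (S − R)(tg) + (R(tg) − A e^{−tg})`. [folklore] -/
theorem period_pt_radius {R3 Rg S3 Sg E X L : ℝ} (h1 : |Rg - E| ≤ 28) (hσg : |Sg - Rg| ≤ 37 / 2)
    (hσ3 : |S3 - R3| ≤ 37 / 2) (hS : |S3 - Sg| ≤ X) (hX : X ≤ 765 + 48 * L) :
    |R3 - E| ≤ 830 + 48 * L := by
  rw [abs_le] at h1 hσg hσ3 hS ⊢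
  constructor <;> linarith

/-- Pointwise bond decay after `t₃`: `t − (τ⁺ + 250/A) ≥ 16 log A/A` makes
`A e^{−(A/4)(t − τ⁺ − 250/A)} ≤ A e^{−log A} = 1`, so `v ≤ 1 + 24/A ≤ 3/2`. [folklore] -/
theorem period_pt_vdecay {A τ t vt : ℝ} (hA : 40000 ≤ A) (h16 : 16 * Real.log A / A ≤ t - τ)
    (hvf : vt ≤ A * Real.exp (-(A / 4) * (t - τ)) + 24 / A) : vt ≤ 3 / 2 := by
  have hA0 : 0 < A := by linarith
  have hL0 : 0 ≤ Real.log A := Real.log_nonneg (by linarith)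
  have h1 : -(A / 4) * (t - τ) ≤ -Real.log A := by
    have h2 : A / 4 * (16 * Real.log A / A) = 4 * Real.log A := by field_simp; ring
    nlinarith [mul_le_mul_of_nonneg_left h16 (by positivity : (0 : ℝ) ≤ A / 4)]
  have h2 : Real.exp (-(A / 4) * (t - τ)) ≤ A⁻¹ := by
    calc _ ≤ Real.exp (-Real.log A) := Real.exp_le_exp.mpr h1
      _ = A⁻¹ := by rw [Real.exp_neg, Real.exp_log hA0]
  have h3 : A * Real.exp (-(A / 4) * (t - τ)) ≤ 1 := by
    have := mul_le_mul_of_nonneg_left h2 hA0.le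
    rwa [mul_inv_cancel₀ hA0.ne'] at this
  have h4 : 24 / A ≤ 1 / 2 := by rw [div_le_iff₀ hA0]; linarith
  linarith

/-- Pointwise post-flip pinning of the carriers: `gate_flipped_geometry` with `|σ| ≤ 37/2`,
`v ≤ 3/2`, `R ≥ A/3`, plus the radius tracking `|R − X| ≤ 3 + 3(ν − 1) + 12`. [folklore] -/
theorem period_pt_after {ν A U V W X : ℝ} (hν2 : ν ≤ 3 / 2) (hA : 40000 ≤ A) (hvpos : 0 ≤ V)
    (hvt : V ≤ 3 / 2) (hR3 : A / 3 ≤ Real.sqrt ((U - W) ^ 2 + 2 * V ^ 2)) (hDt : U - W ≤ 0)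
    (hσ : |U + W - Real.sqrt ((U - W) ^ 2 + 2 * V ^ 2)| ≤ 37 / 2)
    (hRb : |Real.sqrt ((U - W) ^ 2 + 2 * V ^ 2) - X| ≤ 3 + 3 * (ν - 1) + 4 * 3) :
    |W - X| ≤ 26 ∧ |U| ≤ 10 := by
  have hRpos : 0 < Real.sqrt ((U - W) ^ 2 + 2 * V ^ 2) := by linarith
  obtain ⟨hU, hW⟩ := gate_flipped_geometry rfl hRpos hDt hσ
  have hv2R : V ^ 2 / Real.sqrt ((U - W) ^ 2 + 2 * V ^ 2) ≤ 1 / 4 := by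
    rw [div_le_iff₀ hRpos]
    have : V ^ 2 ≤ (3 / 2) ^ 2 := pow_le_pow_left₀ hvpos hvt 2
    nlinarith
  have htri := abs_sub_le W (Real.sqrt ((U - W) ^ 2 + 2 * V ^ 2)) X
  obtain ⟨hRb1, hRb2⟩ := abs_le.mp hRb
  exact ⟨by linarith, by linarith⟩

/-- **THE GATE OVER ONE PERIOD.** For the damped Toda transfer gate with `P = 3`, seed `≤ Ps`,
`32 Ps ≤ A v(0)`, `−log v(0) ≤ A/10`, half fuse `ℓ = log(A/8) − log v(0)`, rise-end bracket
`τm, τp` and `t₃ = τp + (250 + 16 log A)/A ≤ T`: (i) global brackets; (ii) the first time `tg`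
with `v = A/8` lies in `[τm, τp]`, with the rise brackets on `[0, tg]`; (iii) flipped gate, bond
decay and `w ≥ 3A/10` on `[τp + 250/A, T]`; (iv) the radius at `t₃` is `A e^{−tg} ± (830 + 48 log A)`;
(v) for `t ≥ t₃` the new carrier follows `R(t₃) e^{−ν(t − t₃)}` within `26`, `v ≤ 3/2`,
`|u| ≤ 10`. [folklore] -/
theorem toda_gate_period :
    ∀ (ν Ps T A ℓ τm τp t₃ : ℝ) (u v w p r s : ℝ → ℝ),
    1 ≤ ν → ν ≤ 3 / 2 → 0 ≤ Ps → Ps ≤ 3 → 0 < T → T ≤ 1 / 2 → 40000 ≤ A →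
    u 0 = A → 0 ≤ w 0 → w 0 ≤ 1 → 0 < v 0 → v 0 ≤ 1 →
    32 * Ps ≤ A * v 0 → -Real.log (v 0) ≤ A / 10 →
    ℓ = Real.log (A / 8) - Real.log (v 0) →
    τm = -Real.log (1 - (ℓ - 6 / 5) / A) → τp = -Real.log (1 - (ℓ + 11 / 5) / A) →
    t₃ = τp + (250 + 16 * Real.log A) / A → t₃ ≤ T →
    ContinuousOn u (Set.Icc 0 T) → ContinuousOn v (Set.Icc 0 T) → ContinuousOn w (Set.Icc 0 T) →
    (∀ t ∈ Set.Ico 0 T, HasDerivWithinAt u (-u t - v t ^ 2 + p t) (Set.Ici t) t) →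
    (∀ t ∈ Set.Ico 0 T, HasDerivWithinAt v (v t * (u t - w t) - v t + s t) (Set.Ici t) t) →
    (∀ t ∈ Set.Ico 0 T, HasDerivWithinAt w (-ν * w t + v t ^ 2 + r t) (Set.Ici t) t) →
    (∀ t ∈ Set.Icc 0 T, |p t| ≤ 3) → (∀ t ∈ Set.Icc 0 T, |r t| ≤ 3) →
    (∀ t ∈ Set.Icc 0 T, 0 ≤ s t ∧ s t ≤ Ps) →
    (∀ t ∈ Set.Icc 0 T, 0 < v t ∧ -10 ≤ u t ∧ u t ≤ A + 10 ∧ -(3 / 2) ≤ w t ∧ w t ≤ A + 15 ∧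
      A / 3 ≤ Real.sqrt ((u t - w t) ^ 2 + 2 * v t ^ 2)) ∧
    ∃ tg : ℝ, τm ≤ tg ∧ tg ≤ τp ∧ 0 ≤ tg ∧ t₃ ≤ tg + (255 + 16 * Real.log A) / A ∧
      v tg = A / 8 ∧
      (∀ t ∈ Set.Icc 0 tg, v 0 ≤ v t ∧ v t ≤ A / 8 ∧ A / 2 + 1 ≤ u t - w t ∧
        w t ≤ 1 + v t ^ 2 / A + 3 * t) ∧
      (∀ t ∈ Set.Icc (τp + 250 / A) T,
        u t - w t ≤ -(9 / 10) * Real.sqrt ((u t - w t) ^ 2 + 2 * v t ^ 2) ∧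
        v t ≤ A * Real.exp (-(A / 4) * (t - (τp + 250 / A))) + 24 / A ∧ 3 * A / 10 ≤ w t) ∧
      |Real.sqrt ((u t₃ - w t₃) ^ 2 + 2 * v t₃ ^ 2) - A * Real.exp (-tg)| ≤
        830 + 48 * Real.log A ∧
      (∀ t ∈ Set.Icc t₃ T, |w t - Real.sqrt ((u t₃ - w t₃) ^ 2 + 2 * v t₃ ^ 2) *
          Real.exp (-ν * (t - t₃))| ≤ 26 ∧ v t ≤ 3 / 2 ∧ |u t| ≤ 10) := by
  intro ν Ps T A ℓ τm τp t₃ u v w p r s hν1 hν2 hPs0 hPs3 hT0 hT hA hu0 hw0 hw1 hv0 hv1 hPsv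
    hlogv hℓ hτm hτp ht₃ ht₃T hu hv hw hu' hv' hw' hp hr hs
  have hν2' : ν ≤ 2 := by linarith only [hν2]
  have hA0 : 0 < A := by linarith only [hA]
  have hP : (0 : ℝ) ≤ 3 := by norm_num
  have hA1 : 1000 * (1 + (3 : ℝ)) ≤ A := by linarith only [hA]
  have hA4 : 10000 * (1 + (3 : ℝ)) ≤ A := by linarith only [hA]
  have hA400 : 400 * (1 + (3 : ℝ)) ≤ A := by linarith only [hA]
  have hs3 : ∀ t ∈ Icc 0 T, 0 ≤ s t ∧ s t ≤ 3 := fun t ht => ⟨(hs t ht).1, (hs t ht).2.trans hPs3⟩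
  have hs0 : ∀ t ∈ Icc 0 T, 0 ≤ s t := fun t ht => (hs t ht).1
  have h250A : (0 : ℝ) ≤ 250 / A := by positivity
  have hlogA0 : 0 ≤ Real.log A := Real.log_nonneg (by linarith only [hA])
  -- the landed phase lemmas
  have hsig := toda_gate_sigma ν 3 T A u v w p r s hν1 hν2' hP hT0 hT hA1 hu0 hw0 hw1 hv0 hv1 hu
    hv hw hu' hv' hw' hp hr hs3
  have hlin := riseClock_lin hν1 hP hu0 hw0 hv0 hu hv hw hu' hv' hw' hp hr hs0
  have hRad := toda_gate_R ν 3 T A u v w p r s hν1 hν2' hP hT0 hT hA1 hu0 hw0 hw1 hv0 hv1 hu hv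
    hw hu' hv' hw' hp hr hs3
  have hclk := toda_rise_clock ν 3 Ps T A u v w p r s hν1 hν2' hP hPs0 hPs3 hT0 hT hA400 hu0 hw0
    hw1 hv0 hv1 hu hv hw hu' hv' hw' hp hr hs
  ------------------------------------------------------------------ (i)
  have hI : ∀ t ∈ Icc 0 T, 0 < v t ∧ -10 ≤ u t ∧ u t ≤ A + 10 ∧ -(3 / 2) ≤ w t ∧
      w t ≤ A + 15 ∧ A / 3 ≤ Real.sqrt ((u t - w t) ^ 2 + 2 * v t ^ 2) ∧
      |u t + w t - Real.sqrt ((u t - w t) ^ 2 + 2 * v t ^ 2)| ≤ 37 / 2 := by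
    intro t ht
    obtain ⟨-, hwlo, -, hSup, hR3, hσ⟩ := hsig t ht
    obtain ⟨h1, h2, h3, h4, h5⟩ := period_pt_apriori hν2 (ht.2.trans hT) hwlo hSup hσ
    exact ⟨(hlin t ht).1, h1, h2, h3, h4, hR3, h5⟩
  ------------------------------------------------------------------ (ii) the gate time
  obtain ⟨hqp0, hqm_pos, hqA, hqA', hτpm⟩ := period_levels hA hlogv hℓ
  have hqp_pos : 0 < 1 - (ℓ + 11 / 5) / A := by linarith only [hqp0]
  have hv08 : v 0 ≤ A / 8 := by linarith only [hv1, hA]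
  have htgmem : maximalTimeP (fun x => v x ≤ A / 8) 0 T ∈ Icc 0 T :=
    maximalTimeP_le_const_mem hT0.le hv08
  have h8 : ∀ t ∈ Icc 0 (maximalTimeP (fun x => v x ≤ A / 8) 0 T), v t ≤ A / 8 := fun t ht =>
    maximalTimeP_le_const_spec hT0.le hv hv08 ht
  have hexit : maximalTimeP (fun x => v x ≤ A / 8) 0 T < T →
      v (maximalTimeP (fun x => v x ≤ A / 8) 0 T) = A / 8 := fun hlt =>
    eq_of_maximalTimeP_le_const_lt hT0.le hv hv08 hlt
  generalize maximalTimeP (fun x => v x ≤ A / 8) 0 T = tg at htgmem h8 hexit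
  have htgτp : tg < τp := by
    obtain ⟨hvt, -, -, -, -, hlow, -⟩ := hclk tg htgmem h8
    rw [hτp]
    exact period_before hA htgmem.1 (htgmem.2.trans hT) hv0 hvt (h8 tg ⟨htgmem.1, le_rfl⟩) hℓ
      hqp_pos hqA hlow
  have h250 : τp + 250 / A ≤ t₃ := by
    rw [ht₃, add_div]
    linarith only [div_nonneg (by positivity : (0 : ℝ) ≤ 16 * Real.log A) hA0.le]
  have htgT : tg < T := by linarith only [htgτp, h250, ht₃T, h250A]
  have hvtg : v tg = A / 8 := hexit htgT
  have htgτm : τm < tg := by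
    obtain ⟨-, -, -, -, -, -, hup⟩ := hclk tg htgmem h8
    rw [hvtg] at hup
    rw [hτm]
    exact period_after hA htgmem.1 (htgmem.2.trans hT) hv0 hPs0 hPsv hℓ hqm_pos hqA' hup
  -- rise brackets on `[0, tg]`
  have hD : ∀ τ ∈ Icc 0 tg, A / 2 + 1 ≤ u τ - w τ :=
    riseClock_boot hν1 hP hT hA400 hu0 hw0 hw1 hv0 hu hv hw hu' hv' hw' hp hr hs0 htgmem h8
  have hph : ∀ t ∈ Icc 0 tg, A * Real.exp (-t) - v t ^ 2 / A - 3 * t ≤ u t ∧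
      w t ≤ 1 + v t ^ 2 / A + 3 * t :=
    riseClock_phase (P := 3) hν1 hP hA0 htgmem.2 hu0 hw1 hu hv hw hu' hv' hw' hp hr hs0
      (fun x hx => (hlin x hx).1) (fun x hx => hD x (Ico_subset_Icc_self hx))
  have hvmono : ∀ t ∈ Icc 0 tg, v 0 ≤ v t := fun t ht =>
    le_of_deriv_right_nonneg (hv.mono (Icc_subset_Icc_right htgmem.2))
      (fun x hx => hv' x ⟨hx.1, hx.2.trans_le htgmem.2⟩)
      (fun x hx => by
        have hvx := (hlin x ⟨hx.1, hx.2.le.trans htgmem.2⟩).1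
        have hDx := hD x (Ico_subset_Icc_self hx)
        have hsx := hs0 x ⟨hx.1, hx.2.le.trans htgmem.2⟩
        have h1 : 0 ≤ v x * (u x - w x - 1) := mul_nonneg hvx.le (by linarith only [hDx, hA])
        have e : v x * (u x - w x) - v x + s x = v x * (u x - w x - 1) + s x := by ring
        rw [e]
        linarith only [h1, hsx]) t ht
  ------------------------------------------------------------------ (iii) the flip
  have htgT' : tg + 250 / A ≤ T := by linarith only [htgτp, h250, ht₃T]
  have hflip := toda_gate_flip_of_entry ν 3 T A tg u v w p r s hν1 hν2' hP hT0 hT hA4 hu0 hw0 hw1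
    hv0 hv1 hu hv hw hu' hv' hw' hp hr hs3 htgmem htgT' hvtg.ge
    (by linarith only [hD tg ⟨htgmem.1, le_rfl⟩, hA])
  have hIII : ∀ t ∈ Icc (τp + 250 / A) T,
      u t - w t ≤ -(9 / 10) * Real.sqrt ((u t - w t) ^ 2 + 2 * v t ^ 2) ∧
      v t ≤ A * Real.exp (-(A / 4) * (t - (τp + 250 / A))) + 24 / A ∧ 3 * A / 10 ≤ w t := by
    intro t ht
    have ht' : t ∈ Icc (tg + 250 / A) T := ⟨by linarith only [ht.1, htgτp], ht.2⟩
    obtain ⟨hDf, hvf⟩ := hflip t ht'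
    have hexp : Real.exp (-(A / 4) * (t - (tg + 250 / A))) ≤
        Real.exp (-(A / 4) * (t - (τp + 250 / A))) := by
      refine Real.exp_le_exp.mpr ?_
      have := mul_le_mul_of_nonneg_left htgτp.le (by positivity : (0 : ℝ) ≤ A / 4)
      linarith only [this]
    refine ⟨hDf, ?_, ?_⟩
    · have h1 := mul_le_mul_of_nonneg_left hexp hA0.le
      have e : (8 * 3 / A : ℝ) = 24 / A := by norm_num
      linarith only [h1, e, hvf]
    · have htT : t ∈ Icc 0 T := ⟨by linarith only [ht.1, htgτp, htgmem.1, h250A], ht.2⟩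
      obtain ⟨-, -, -, -, -, hR3, hσ⟩ := hI t htT
      exact period_pt_flip hA hR3 hσ hDf
  ------------------------------------------------------------------ (iv) the radius at t₃
  have htgt₃ : tg ≤ t₃ := by linarith only [htgτp, h250, h250A]
  have ht₃0 : 0 ≤ t₃ := htgmem.1.trans htgt₃
  have hδ : t₃ - tg ≤ (255 + 16 * Real.log A) / A := by
    have e : (255 + 16 * Real.log A) / A = 5 / A + (250 + 16 * Real.log A) / A := by
      rw [← add_div]; ring_nf
    have e2 : τp - τm ≤ 5 / A := by rw [hτp, hτm]; exact hτpm
    linarith only [e, e2, htgτm, ht₃]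
  have hS : |u t₃ + w t₃ - (u tg + w tg)| ≤ 3 * A * (t₃ - tg) := by
    refine abs_sub_le_mul_of_abs_deriv_right_le (f := fun y => u y + w y) (a := tg) (b := t₃)
      ((hu.add hw).mono (Icc_subset_Icc htgmem.1 ht₃T))
      (fun x hx => (hu' x ⟨htgmem.1.trans hx.1, hx.2.trans_le ht₃T⟩).add
        (hw' x ⟨htgmem.1.trans hx.1, hx.2.trans_le ht₃T⟩))
      (fun x hx => ?_) t₃ ⟨htgt₃, le_rfl⟩
    have hx' : x ∈ Icc 0 T := ⟨htgmem.1.trans hx.1, (hx.2.trans_le ht₃T).le⟩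
    obtain ⟨-, hulo, huhi, hwlo, hwhi, -, -⟩ := hI x hx'
    exact period_pt_slope hν1 hν2 hA hulo huhi hwlo hwhi (hp x hx') (hr x hx')
  have hIV : |Real.sqrt ((u t₃ - w t₃) ^ 2 + 2 * v t₃ ^ 2) - A * Real.exp (-tg)| ≤
      830 + 48 * Real.log A := by
    have h1 := hRad.1 tg htgmem h8
    have h1' : |Real.sqrt ((u tg - w tg) ^ 2 + 2 * v tg ^ 2) - A * Real.exp (-tg)| ≤ 28 :=
      h1.trans (by linarith only [hν2, htgmem.2.trans hT, htgmem.1])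
    obtain ⟨-, -, -, -, -, -, hσg⟩ := hI tg htgmem
    obtain ⟨-, -, -, -, -, -, hσ3⟩ := hI t₃ ⟨ht₃0, ht₃T⟩
    have h2 : 3 * A * (t₃ - tg) ≤ 765 + 48 * Real.log A := by
      have := mul_le_mul_of_nonneg_left hδ (by positivity : (0 : ℝ) ≤ 3 * A)
      have e : 3 * A * ((255 + 16 * Real.log A) / A) = 765 + 48 * Real.log A := by
        field_simp; ring
      linarith only [this, e]
    exact period_pt_radius h1' hσg hσ3 hS h2
  ------------------------------------------------------------------ (v) after t₃
  have hsmall : ∀ t ∈ Icc t₃ T, u t - w t ≤ 0 ∧ v t ≤ 3 / 2 := by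
    intro t ht
    have ht' : t ∈ Icc (τp + 250 / A) T := ⟨by linarith only [ht.1, h250], ht.2⟩
    obtain ⟨hDf, hvf, -⟩ := hIII t ht'
    have hR0 := Real.sqrt_nonneg ((u t - w t) ^ 2 + 2 * v t ^ 2)
    refine ⟨by linarith only [hDf, hR0], ?_⟩
    have h16 : 16 * Real.log A / A ≤ t - (τp + 250 / A) := by
      have e : t₃ - (τp + 250 / A) = 16 * Real.log A / A := by rw [ht₃]; field_simp; ring
      linarith only [ht.1, e]
    exact period_pt_vdecay hA h16 hvf
  have hV : ∀ t ∈ Icc t₃ T, |w t - Real.sqrt ((u t₃ - w t₃) ^ 2 + 2 * v t₃ ^ 2) *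
      Real.exp (-ν * (t - t₃))| ≤ 26 ∧ v t ≤ 3 / 2 ∧ |u t| ≤ 10 := by
    intro t ht
    obtain ⟨hDt, hvt⟩ := hsmall t ht
    have htT : t ∈ Icc 0 T := ⟨ht₃0.trans ht.1, ht.2⟩
    obtain ⟨hvpos, -, -, -, -, hR3, hσ⟩ := hI t htT
    have hRb := hRad.2 t₃ ⟨ht₃0, ht₃T⟩ t ht (fun t' ht' => by
      obtain ⟨h1, h2⟩ := hsmall t' ⟨ht'.1, ht'.2.trans ht.2⟩
      exact ⟨h1, by linarith only [h2]⟩)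
    obtain ⟨h1, h2⟩ := period_pt_after hν2 hA hvpos.le hvt hR3 hDt hσ hRb
    exact ⟨h1, hvt, h2⟩
  ------------------------------------------------------------------ assembly
  refine ⟨fun t ht => ?_, tg, htgτm.le, htgτp.le, htgmem.1, by linarith only [hδ], hvtg,
    fun t ht => ⟨hvmono t ht, h8 t ht, hD t ht, (hph t ht).2⟩, hIII, hIV, hV⟩
  obtain ⟨h1, h2, h3, h4, h5, h6, -⟩ := hI t ht
  exact ⟨h1, h2, h3, h4, h5, h6⟩

end Summit.NavierStokesRegularity.NavierStokesRegularity.Theorems.PerpetualPumpCircuitPump
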